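import Literature.Geometry.Riemannian.CosDistHeatFlowPositivity
import Literature.Geometry.Riemannian.StaticHeatL2Smoothing
import Literature.Geometry.Riemannian.HeatFlowDisplacement
import Literature.Geometry.Riemannian.ColdingHessianEstimate
import HarnessLib

/-!
# Colding's smoothed cosine of the distance: a smooth `f ≈ cos d_p` with `Δf + m f ≥ 0` small
# in `L²` (Colding 1996a, §1; *Aspects of Ricci curvature* §1, proof of Thm. 1.1)

On a closed `m`-manifold (`m ≥ 2`) with `Ric ≥ (m − 1) g`, let `p, q` be almost antipodal,
`d(p, q) ≥ π − δ` (`0 ≤ δ < π/(2m)`), and `τ > 0`. Put `u_p = cos d(p, ·)` and let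
`f = P_τ u_p` be its heat-flow smoothing (`P_τ = P_{0→τ}` the heat propagation of `g`). Then

* `contMDiff_heatValueC_cos_edist` — `f` is `C^∞`;
* `abs_heatValueC_cos_edist_le_one` — `|f| ≤ 1`;
* `abs_heatValueC_cos_edist_sub_le` — `|f − cos d_p| ≤ √(2mτ)` (`u_p` is `1`-Lipschitz;
  `abs_heatValueC_sub_self_le_of_lipschitz`);
* `laplaceBeltrami_heatValueC_cos_edist_add_mul_nonneg` (`CosDistHeatFlowPositivity.lean`) —
  `Δf + m f ≥ 0`;
* `abs_cos_edist_add_cos_edist_le` — `|cos d_p + cos d_q| ≤ η := δ + (2mπ^{m−1}δ)^{1/m}`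
  uniformly (the uniform excess bound `excess_pow_le_of_edist_ge_pi_sub`);
* **`integral_sq_laplaceBeltrami_add_mul_heatValueC_cos_edist_le`** —
  `∫ (Δf + m f)² dV ≤ (4/τ² + 2m²) η² Vol(M)`: with `w = u_p + u_q`, `|w| ≤ η`,
  `0 ≤ Δf_p + m f_p ≤ (Δ + m) P_τ w` pointwise (the same for `q`), and
  `∫ ((Δ + m)P_τ w)² ≤ 2 ∫ (Δ P_τ w)² + 2m² ∫ (P_τ w)² ≤ 4η²V/τ² + 2m²η²V`
  (`integral_sq_laplaceBeltrami_heatValueC_le`);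
* **`exists_smooth_approx_cos_edist`** — the package: a `C^∞` function `f` with `|f| ≤ 1`,
  `|f − cos d_p| ≤ √(2mτ)`, `Δf + mf ≥ 0` and `∫ (Δf + mf)² ≤ (4/τ² + 2m²) η² Vol(M)`;
* **`exists_smooth_approx_cos_riemannianEDist`** — the same in the binders of
  `Colding1996_volume_ghClose` (`Bundle.ContMDiffRiemannianMetric`, `riemannianMeasure`,
  `Manifold.riemannianEDist`), together with Colding's `L²` Hessian estimate
  (`colding_integral_normSq_hessian_add_smul_le_sqrt`):
  `∫ |Hess f + f g|² ≤ K + (m − 1) √(K · Vol(M))`, `K = (4/τ² + 2m²) η² Vol(M)` — steps A2(i)+(ii)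
  of the printed proof ("the Hessian of a function that approximates `cos d(p,·)` is almost `−fg`").

This is step A2(i) of Colding's proof of the volume sphere theorem (`Colding1996_volume_ghClose`):
"`cos d_p` is, after smoothing, an almost eigenfunction `Δf ≈ −mf`". Everything here is proved; no
definitions, no named facts (D-0026).

## References

* T. H. Colding, *Shape of manifolds with positive Ricci curvature*, Invent. Math. 124 (1996)
  175–191, §1 (Lemma 1.4 ff.). [Colding1996Shape]
* T. H. Colding, *Aspects of Ricci curvature*, in *Comparison Geometry* (1997), §1, proof of
  Thm. 1.1. [Colding1997Aspects]
-/

noncomputable section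

open Set Function Filter MeasureTheory Measure
open scoped Manifold ContDiff Topology ENNReal NNReal

namespace Literature.Geometry.Riemannian

open Lorentzian Lorentzian.PseudoRiemannianMetric

section CosDist

variable {m : ℕ} {M : Type*} [TopologicalSpace M] [T2Space M] [SecondCountableTopology M]
  [ChartedSpace (EuclideanSpace ℝ (Fin m)) M] [IsManifold (𝓡 m) ∞ M]
  [MeasurableSpace M] [BorelSpace M]
  (g : PseudoRiemannianMetric (𝓡 m) ∞ (EuclideanSpace ℝ (Fin m)) (TangentSpace (𝓡 m) : M → Type _))
  [ConnectedSpace M] [CompactSpace M] [g.HasLeviCivita]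

omit [g.HasLeviCivita] in
/-- **The heat-flow smoothing `P_τ cos d_p` is `C^∞`** for `τ > 0`
(`contMDiff_heatValueC_slice`). [cite: Colding1996Shape, §1] -/
theorem contMDiff_heatValueC_cos_edist (hg : g.IsRiemannian) (p : M) {τ : ℝ} (hτ : 0 < τ) :
    ContMDiff (𝓡 m) 𝓘(ℝ, ℝ) ∞
      fun x ↦ heatValueC (fun _ : ℝ ↦ g) 0 τ x (fun y ↦ Real.cos (g.edist hg p y).toReal) :=
  contMDiff_heatValueC_slice (isContMDiffFamilyOn_const g univ) (fun _ ↦ hg) hτ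
    (continuous_cos_edist g hg p)

omit [g.HasLeviCivita] in
/-- **`|P cos d_p| ≤ 1`** (maximum principle, `heatValueC_mono` against the constants `±1`).
[cite: Colding1996Shape, §1] -/
theorem abs_heatValueC_cos_edist_le_one (hg : g.IsRiemannian) (p : M) (s t : ℝ) (x : M) :
    |heatValueC (fun _ : ℝ ↦ g) s t x (fun y ↦ Real.cos (g.edist hg p y).toReal)| ≤ 1 := by
  have hh : IsContMDiffFamilyOn ∞ (fun _ : ℝ ↦ g) univ := isContMDiffFamilyOn_const g univ
  have hR : ∀ r : ℝ, ((fun _ : ℝ ↦ g) r).IsRiemannian := fun _ ↦ hg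
  have hc := continuous_cos_edist g hg p
  rw [abs_le]
  constructor
  · have h1 := heatValueC_mono hh hR (s := s) (t := t) x continuous_const hc
      (fun y ↦ Real.neg_one_le_cos (g.edist hg p y).toReal)
    rwa [heatValueC_const hh hR] at h1
  · have h1 := heatValueC_mono hh hR (s := s) (t := t) x hc continuous_const
      (fun y ↦ Real.cos_le_one (g.edist hg p y).toReal)
    rwa [heatValueC_const hh hR] at h1

/-- **`|P_τ cos d_p − cos d_p| ≤ √(2mτ)`** under `Ric ≥ (m-1) g`, `m ≥ 1` (so `Ric ≥ 0`):
`cos d_p` is `1`-Lipschitz (`|cos a − cos b| ≤ |a − b|`, `|d(p,y) − d(p,z)| ≤ d(y,z)`) and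
`abs_heatValueC_sub_self_le_of_lipschitz`. [cite: Colding1996Shape, §1] -/
theorem abs_heatValueC_cos_edist_sub_le (hg : g.IsRiemannian) (hm : 1 ≤ m)
    (hRic : ∀ (x : M) (w : TangentSpace (𝓡 m) x), ((m : ℝ) - 1) * g.val x w w ≤ g.ricci x w w)
    (p x : M) {τ : ℝ} (hτ : 0 < τ) :
    |heatValueC (fun _ : ℝ ↦ g) 0 τ x (fun y ↦ Real.cos (g.edist hg p y).toReal) -
        Real.cos (g.edist hg p x).toReal| ≤ Real.sqrt (2 * m * τ) := by
  have hRic0 : ∀ (z : M) (w : TangentSpace (𝓡 m) z), 0 ≤ g.leviCivita.ricci z w w := by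
    intro z w
    have h1 : (0 : ℝ) ≤ ((m : ℝ) - 1) * g.val z w w := by
      refine mul_nonneg ?_ ?_
      · have : (1 : ℝ) ≤ m := by exact_mod_cast hm
        linarith
      · by_cases hw : w = 0
        · rw [hw]; simp
        · exact (hg z w hw).le
    exact h1.trans (hRic z w)
  have hlip : ∀ y z : M, |Real.cos (g.edist hg p y).toReal - Real.cos (g.edist hg p z).toReal| ≤
      1 * (g.edist hg y z).toReal := by
    intro y z
    rw [one_mul]
    refine (Real.abs_cos_sub_cos_le _ _).trans ?_
    letI := g.metricSpace hg
    have h1 := abs_dist_sub_le y z p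
    rw [dist_comm y p, dist_comm z p] at h1
    exact h1
  have h := abs_heatValueC_sub_self_le_of_lipschitz g hg hRic0 (continuous_cos_edist g hg p)
    zero_le_one hlip x hτ
  rwa [one_mul, sub_zero] at h

/-- **`|cos d_p + cos d_q| ≤ δ + (2mπ^{m−1}δ)^{1/m}` uniformly for almost antipodal `p, q`**
(`d(p, q) ≥ π − δ`, `0 ≤ δ < π/(2m)`, `Ric ≥ (m-1) g`, `m ≥ 2`): `cos a + cos b = cos a − cos(π − b)`,
`|cos a − cos(π − b)| ≤ |a + b − π|`, and `a + b − π = e + (d(p,q) − π)` with the excess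
`0 ≤ e ≤ (2mπ^{m−1}δ)^{1/m}` (`excess_pow_le_of_edist_ge_pi_sub`) and `−δ ≤ d(p,q) − π ≤ 0` (Myers).
[cite: Colding1996Shape, §1] [cite: Colding1997Aspects, §1–§2] -/
theorem abs_cos_edist_add_cos_edist_le (hg : g.IsRiemannian) (hm : 2 ≤ m)
    (hRic : ∀ (x : M) (w : TangentSpace (𝓡 m) x), ((m : ℝ) - 1) * g.val x w w ≤ g.ricci x w w)
    {p q : M} {δ : ℝ} (hδ : 0 ≤ δ) (hδm : δ < Real.pi / (2 * m))
    (hpq : ENNReal.ofReal (Real.pi - δ) ≤ g.edist hg p q) (y : M) :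
    |Real.cos (g.edist hg p y).toReal + Real.cos (g.edist hg q y).toReal| ≤
      δ + (2 * m * Real.pi ^ (m - 1) * δ) ^ ((m : ℝ)⁻¹) := by
  haveI : LocallyCompactSpace M := Manifold.locallyCompact_of_finiteDimensional (𝓡 m)
  haveI : T3Space M := inferInstance
  have hm0 : m ≠ 0 := by omega
  have hfinE : Module.finrank ℝ (EuclideanSpace ℝ (Fin m)) = m := finrank_euclideanSpace_fin
  -- the excess at `y`
  set a : ℝ := (g.edist hg p y).toReal with ha
  set b : ℝ := (g.edist hg y q).toReal with hb
  set dpq : ℝ := (g.edist hg p q).toReal with hdpq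
  have hb' : (g.edist hg q y).toReal = b := by rw [hb, PseudoRiemannianMetric.edist_comm]
  have hex := excess_pow_le_of_edist_ge_pi_sub g hg hm hRic hδ hδm hpq y
  have he0 : 0 ≤ a + b - dpq := by
    letI := g.metricSpace hg
    have := dist_triangle p y q
    show 0 ≤ dist p y + dist y q - dist p q
    linarith
  set C : ℝ := 2 * m * Real.pi ^ (m - 1) * δ with hC
  have hC0 : 0 ≤ C := by positivity
  have he : a + b - dpq ≤ C ^ ((m : ℝ)⁻¹) := by
    have h1 : ((a + b - dpq) ^ m) ^ ((m : ℝ)⁻¹) ≤ C ^ ((m : ℝ)⁻¹) :=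
      Real.rpow_le_rpow (pow_nonneg he0 m) hex (by positivity)
    rwa [Real.pow_rpow_inv_natCast he0 hm0] at h1
  -- `π − δ ≤ d(p, q) ≤ π`
  have hle_pi : dpq ≤ Real.pi := by
    have h := edist_le_pi_div_sqrt_of_ricci_ge_of_compactSpace g hg (by rw [hfinE]; exact hm)
      one_pos (fun y w ↦ by rw [hfinE, mul_one]; exact hRic y w) p q
    rw [Real.sqrt_one, div_one] at h
    exact ENNReal.toReal_le_of_le_ofReal Real.pi_pos.le h
  have hge : Real.pi - δ ≤ dpq :=
    (ENNReal.ofReal_le_iff_le_toReal (PseudoRiemannianMetric.edist_ne_top hg p q)).1 hpq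
  -- `cos a + cos b = cos a − cos (π − b)`
  rw [hb']
  have h1 : Real.cos a + Real.cos b = Real.cos a - Real.cos (Real.pi - b) := by
    rw [Real.cos_pi_sub]; ring
  rw [h1]
  refine (Real.abs_cos_sub_cos_le _ _).trans ?_
  rw [abs_le]
  constructor <;> nlinarith [Real.rpow_nonneg hC0 ((m : ℝ)⁻¹)]

/-- **The `L²` bound `∫ (Δf + m f)² ≤ (4/τ² + 2m²) η² Vol(M)` for `f = P_τ cos d_p`**, with
`η = δ + (2mπ^{m−1}δ)^{1/m}`, given an almost antipode `q` of `p` (`d(p, q) ≥ π − δ`): with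
`w = cos d_p + cos d_q`, `|w| ≤ η`, one has pointwise
`0 ≤ Δf_p + m f_p ≤ (Δf_p + m f_p) + (Δf_q + m f_q) = (Δ + m) P_τ w`, hence
`∫ (Δf_p + mf_p)² ≤ ∫ ((Δ+m)P_τ w)² ≤ 2∫(ΔP_τ w)² + 2m²∫(P_τ w)² ≤ 4η²V/τ² + 2m²η²V`
(`integral_sq_laplaceBeltrami_heatValueC_le`, `|P_τ w| ≤ η`).
[cite: Colding1996Shape, §1, Lemma 1.4 ff.] [cite: Colding1997Aspects, §1, proof of Thm. 1.1] -/
theorem integral_sq_laplaceBeltrami_add_mul_heatValueC_cos_edist_le (hg : g.IsRiemannian)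
    (hm : 2 ≤ m)
    (hRic : ∀ (x : M) (w : TangentSpace (𝓡 m) x), ((m : ℝ) - 1) * g.val x w w ≤ g.ricci x w w)
    {p q : M} {δ : ℝ} (hδ : 0 ≤ δ) (hδm : δ < Real.pi / (2 * m))
    (hpq : ENNReal.ofReal (Real.pi - δ) ≤ g.edist hg p q) {τ : ℝ} (hτ : 0 < τ) :
    ∫ x, (g.laplaceBeltrami
        (fun y ↦ heatValueC (fun _ : ℝ ↦ g) 0 τ y (fun z ↦ Real.cos (g.edist hg p z).toReal)) x +
        m * heatValueC (fun _ : ℝ ↦ g) 0 τ x (fun z ↦ Real.cos (g.edist hg p z).toReal)) ^ 2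
        ∂g.riemVolume ≤
      (4 / τ ^ 2 + 2 * (m : ℝ) ^ 2) * (δ + (2 * m * Real.pi ^ (m - 1) * δ) ^ ((m : ℝ)⁻¹)) ^ 2 *
        (g.riemVolume univ).toReal := by
  have hh : IsContMDiffFamilyOn ∞ (fun _ : ℝ ↦ g) univ := isContMDiffFamilyOn_const g univ
  have hR : ∀ r : ℝ, ((fun _ : ℝ ↦ g) r).IsRiemannian := fun _ ↦ hg
  have h2 : (2 : ℕ∞ω) ≤ ((⊤ : ℕ∞) : ℕ∞ω) := WithTop.coe_le_coe.mpr le_top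
  haveI : IsFiniteMeasure g.riemVolume := ⟨g.riemVolume_univ_lt_top⟩
  set η : ℝ := δ + (2 * m * Real.pi ^ (m - 1) * δ) ^ ((m : ℝ)⁻¹) with hη
  set V : ℝ := (g.riemVolume univ).toReal with hV
  -- the data and their propagations
  set up : M → ℝ := fun z ↦ Real.cos (g.edist hg p z).toReal with hup
  set uq : M → ℝ := fun z ↦ Real.cos (g.edist hg q z).toReal with huq
  set w : M → ℝ := fun z ↦ up z + uq z with hw
  have hupc : Continuous up := continuous_cos_edist g hg p
  have huqc : Continuous uq := continuous_cos_edist g hg q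
  have hwc : Continuous w := hupc.add huqc
  set fp : M → ℝ := fun x ↦ heatValueC (fun _ : ℝ ↦ g) 0 τ x up with hfp
  set fq : M → ℝ := fun x ↦ heatValueC (fun _ : ℝ ↦ g) 0 τ x uq with hfq
  set Fw : M → ℝ := fun x ↦ heatValueC (fun _ : ℝ ↦ g) 0 τ x w with hFw
  have hFw_eq : ∀ x, Fw x = fp x + fq x := fun x ↦ heatValueC_add hh hR x hupc huqc
  have hfps : ContMDiff (𝓡 m) 𝓘(ℝ, ℝ) ∞ fp := contMDiff_heatValueC_slice hh hR hτ hupc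
  have hfqs : ContMDiff (𝓡 m) 𝓘(ℝ, ℝ) ∞ fq := contMDiff_heatValueC_slice hh hR hτ huqc
  have hFws : ContMDiff (𝓡 m) 𝓘(ℝ, ℝ) ∞ Fw := contMDiff_heatValueC_slice hh hR hτ hwc
  -- `|w| ≤ η`, `|P_τ w| ≤ η`
  have hwB : ∀ y, |w y| ≤ η := fun y ↦ abs_cos_edist_add_cos_edist_le g hg hm hRic hδ hδm hpq y
  have hFwB : ∀ x, |Fw x| ≤ η := by
    intro x
    rw [abs_le]
    constructor
    · have h1 := heatValueC_mono hh hR (s := 0) (t := τ) x continuous_const hwc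
        (fun z ↦ (abs_le.1 (hwB z)).1)
      rwa [heatValueC_const hh hR] at h1
    · have h1 := heatValueC_mono hh hR (s := 0) (t := τ) x hwc continuous_const
        (fun z ↦ (abs_le.1 (hwB z)).2)
      rwa [heatValueC_const hh hR] at h1
  -- Laplacians: continuity and additivity
  have hΔc : ∀ {φ : M → ℝ}, ContMDiff (𝓡 m) 𝓘(ℝ, ℝ) ∞ φ →
      Continuous fun x ↦ g.laplaceBeltrami φ x := by
    intro φ hφ
    have h1 : Continuous fun p : M × ℝ ↦ ((fun _ : ℝ ↦ g) p.2).laplaceBeltrami φ p.1 :=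
      continuous_laplaceBeltrami_family hh hφ
    refine (h1.comp (Continuous.prodMk_left (0 : ℝ))).congr fun x ↦ ?_
    simp only [Function.comp_apply]
  have hΔadd : ∀ x, g.laplaceBeltrami Fw x = g.laplaceBeltrami fp x + g.laplaceBeltrami fq x := by
    intro x
    have e1 : Fw = fun y ↦ fp y + 1 * fq y := funext fun y ↦ by rw [hFw_eq, one_mul]
    rw [e1, laplaceBeltrami_eq_dalembertian, laplaceBeltrami_eq_dalembertian,
      laplaceBeltrami_eq_dalembertian,
      dalembertian_add_const_mul_of_contMDiffAt g ((hfps x).of_le h2) ((hfqs x).of_le h2) 1, one_mul]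
  -- pointwise: `0 ≤ (Δ+m)f_p ≤ (Δ+m)F_w`, `((Δ+m)F_w)² ≤ 2(ΔF_w)² + 2m²F_w²`
  have hp0 : ∀ x, 0 ≤ g.laplaceBeltrami fp x + m * fp x := fun x ↦
    laplaceBeltrami_heatValueC_cos_edist_add_mul_nonneg g hg hm hRic p x hτ
  have hq0 : ∀ x, 0 ≤ g.laplaceBeltrami fq x + m * fq x := fun x ↦
    laplaceBeltrami_heatValueC_cos_edist_add_mul_nonneg g hg hm hRic q x hτ
  have hpt : ∀ x, (g.laplaceBeltrami fp x + m * fp x) ^ 2 ≤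
      2 * (g.laplaceBeltrami Fw x) ^ 2 + 2 * (m : ℝ) ^ 2 * (Fw x) ^ 2 := by
    intro x
    have hle : g.laplaceBeltrami fp x + m * fp x ≤ g.laplaceBeltrami Fw x + m * Fw x := by
      rw [hΔadd, hFw_eq]; nlinarith [hq0 x]
    calc (g.laplaceBeltrami fp x + m * fp x) ^ 2 ≤ (g.laplaceBeltrami Fw x + m * Fw x) ^ 2 :=
          pow_le_pow_left₀ (hp0 x) hle 2
      _ ≤ 2 * (g.laplaceBeltrami Fw x) ^ 2 + 2 * (m : ℝ) ^ 2 * (Fw x) ^ 2 := by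
          nlinarith [sq_nonneg (g.laplaceBeltrami Fw x - m * Fw x)]
  -- integrate
  have hi : ∀ {f : M → ℝ}, Continuous f → Integrable f g.riemVolume := fun hf ↦
    hf.integrable_of_hasCompactSupport (HasCompactSupport.of_compactSpace _)
  have hI1 : ∫ x, (g.laplaceBeltrami Fw x) ^ 2 ∂g.riemVolume ≤ 2 * η ^ 2 * V / τ ^ 2 := by
    have h := integral_sq_laplaceBeltrami_heatValueC_le hg hwc hwB hτ
    rwa [sub_zero] at h
  have hI2 : ∫ x, (Fw x) ^ 2 ∂g.riemVolume ≤ η ^ 2 * V := by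
    have h1 : ∫ x, (Fw x) ^ 2 ∂g.riemVolume ≤ ∫ _, η ^ 2 ∂g.riemVolume := by
      refine integral_mono_of_nonneg (Eventually.of_forall fun x ↦ sq_nonneg _)
        (integrable_const _) (Eventually.of_forall fun x ↦ ?_)
      exact sq_le_sq' (abs_le.1 (hFwB x)).1 (abs_le.1 (hFwB x)).2
    rwa [integral_const, smul_eq_mul, mul_comm, measureReal_def] at h1
  calc ∫ x, (g.laplaceBeltrami fp x + m * fp x) ^ 2 ∂g.riemVolume
      ≤ ∫ x, (2 * (g.laplaceBeltrami Fw x) ^ 2 + 2 * (m : ℝ) ^ 2 * (Fw x) ^ 2) ∂g.riemVolume :=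
        integral_mono (hi (((hΔc hfps).add (continuous_const.mul hfps.continuous)).pow 2))
          (hi ((continuous_const.mul ((hΔc hFws).pow 2)).add
            (continuous_const.mul (hFws.continuous.pow 2)))) hpt
    _ = 2 * ∫ x, (g.laplaceBeltrami Fw x) ^ 2 ∂g.riemVolume +
          2 * (m : ℝ) ^ 2 * ∫ x, (Fw x) ^ 2 ∂g.riemVolume := by
        have hiA : Integrable (fun x ↦ 2 * (g.laplaceBeltrami Fw x) ^ 2) g.riemVolume :=
          hi (continuous_const.mul ((hΔc hFws).pow 2))
        have hiB : Integrable (fun x ↦ 2 * (m : ℝ) ^ 2 * (Fw x) ^ 2) g.riemVolume :=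
          hi (continuous_const.mul (hFws.continuous.pow 2))
        rw [integral_add hiA hiB, integral_const_mul, integral_const_mul]
    _ ≤ 2 * (2 * η ^ 2 * V / τ ^ 2) + 2 * (m : ℝ) ^ 2 * (η ^ 2 * V) := by
        gcongr
    _ = (4 / τ ^ 2 + 2 * (m : ℝ) ^ 2) * η ^ 2 * V := by
        field_simp
        ring

/-- **Colding's smoothed cosine of the distance function** (Colding 1996a, §1, Lemma 1.4 ff.;
*Aspects* §1, proof of Thm. 1.1: "`cos d_p` is, after smoothing, an almost solution of
`Δf = −nf`"): on a closed `m`-manifold, `m ≥ 2`, with `Ric ≥ (m − 1) g`, for `p, q` with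
`d(p, q) ≥ π − δ` (`0 ≤ δ < π/(2m)`) and every `τ > 0` there is a `C^∞` function `f`
(namely `P_τ cos d_p`) with `|f| ≤ 1`, `|f − cos d_p| ≤ √(2mτ)`, `Δf + m f ≥ 0` and
`∫ (Δf + m f)² dV ≤ (4/τ² + 2m²) (δ + (2mπ^{m−1}δ)^{1/m})² Vol(M)`.
[cite: Colding1996Shape, §1, Lemma 1.4 ff.] [cite: Colding1997Aspects, §1, proof of Thm. 1.1] -/
theorem exists_smooth_approx_cos_edist (hg : g.IsRiemannian) (hm : 2 ≤ m)
    (hRic : ∀ (x : M) (w : TangentSpace (𝓡 m) x), ((m : ℝ) - 1) * g.val x w w ≤ g.ricci x w w)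
    {p q : M} {δ : ℝ} (hδ : 0 ≤ δ) (hδm : δ < Real.pi / (2 * m))
    (hpq : ENNReal.ofReal (Real.pi - δ) ≤ g.edist hg p q) {τ : ℝ} (hτ : 0 < τ) :
    ∃ f : M → ℝ, ContMDiff (𝓡 m) 𝓘(ℝ, ℝ) ∞ f ∧ (∀ x, |f x| ≤ 1) ∧
      (∀ x, |f x - Real.cos (g.edist hg p x).toReal| ≤ Real.sqrt (2 * m * τ)) ∧
      (∀ x, 0 ≤ g.laplaceBeltrami f x + m * f x) ∧
      ∫ x, (g.laplaceBeltrami f x + m * f x) ^ 2 ∂g.riemVolume ≤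
        (4 / τ ^ 2 + 2 * (m : ℝ) ^ 2) * (δ + (2 * m * Real.pi ^ (m - 1) * δ) ^ ((m : ℝ)⁻¹)) ^ 2 *
          (g.riemVolume univ).toReal :=
  ⟨fun x ↦ heatValueC (fun _ : ℝ ↦ g) 0 τ x (fun y ↦ Real.cos (g.edist hg p y).toReal),
    contMDiff_heatValueC_cos_edist g hg p hτ, fun x ↦ abs_heatValueC_cos_edist_le_one g hg p 0 τ x,
    fun x ↦ abs_heatValueC_cos_edist_sub_le g hg (by omega) hRic p x hτ,
    fun x ↦ laplaceBeltrami_heatValueC_cos_edist_add_mul_nonneg g hg hm hRic p x hτ,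
    integral_sq_laplaceBeltrami_add_mul_heatValueC_cos_edist_le g hg hm hRic hδ hδm hpq hτ⟩

end CosDist

section FactVocabulary

open Bundle
open Literature.Geometry.Lorentzian (riemannianMeasure)

/-- **Colding's almost eigenfunction and its Hessian estimate, in the binders of
`Colding1996_volume_ghClose`** (Colding 1996a, §1; *Aspects* §1, proof of Thm. 1.1): on a closed
connected Riemannian `n`-manifold `(M, h)`, `n ≥ 2`, with `Ric ≥ (n − 1) h`, let `d(p, q) ≥ π − δ`
(`0 ≤ δ < π/(2n)`, Riemannian distance of `h`) and `τ > 0`; put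
`η = δ + (2nπ^{n−1}δ)^{1/n}`, `V = μ_h(M)`, `K = (4/τ² + 2n²) η² V`. Then there is a `C^∞` function
`f` with `|f| ≤ 1`, `|f − cos d_p| ≤ √(2nτ)`, `Δf + nf ≥ 0`, `∫ (Δf + nf)² dμ_h ≤ K` and
`∫ |Hess f + f h|²_h dμ_h ≤ K + (n − 1) √(K V)`
(`exists_smooth_approx_cos_edist` for `g = ofRiemannian h`, whose distance is `riemannianEDist` and
whose volume is `riemannianMeasure h`, combined with `colding_integral_normSq_hessian_add_smul_le_sqrt`
and `∫ f² ≤ V`). Choosing `τ = η` makes all three error terms `ψ(δ | n)`.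
[cite: Colding1996Shape, §1, Lemma 1.4 ff.] [cite: Colding1997Aspects, §1, proof of Thm. 1.1] -/
theorem exists_smooth_approx_cos_riemannianEDist (n : ℕ) (hn : 2 ≤ n)
    (M : Type) [TopologicalSpace M] [T2Space M] [SecondCountableTopology M]
    [ChartedSpace (EuclideanSpace ℝ (Fin n)) M] [IsManifold (𝓡 n) ∞ M] [CompactSpace M]
    [ConnectedSpace M] [MeasurableSpace M] [BorelSpace M]
    (h : Bundle.ContMDiffRiemannianMetric (𝓡 n) ∞ (EuclideanSpace ℝ (Fin n))
      (TangentSpace (𝓡 n) : M → Type _))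
    [(PseudoRiemannianMetric.ofRiemannian h).HasLeviCivita]
    (hRic : ∀ (x : M) (v : TangentSpace (𝓡 n) x),
      ((n : ℝ) - 1) * h.inner x v v ≤ (PseudoRiemannianMetric.ofRiemannian h).ricci x v v)
    {p q : M} {δ : ℝ} (hδ : 0 ≤ δ) (hδn : δ < Real.pi / (2 * n))
    (hpq : ENNReal.ofReal (Real.pi - δ) ≤
      (letI : Bundle.RiemannianBundle (fun x : M ↦ TangentSpace (𝓡 n) x) :=
        ⟨h.toContinuousRiemannianMetric.toRiemannianMetric⟩
      Manifold.riemannianEDist (𝓡 n) p q))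
    {τ : ℝ} (hτ : 0 < τ) :
    letI : Bundle.RiemannianBundle (fun x : M ↦ TangentSpace (𝓡 n) x) :=
      ⟨h.toContinuousRiemannianMetric.toRiemannianMetric⟩
    ∃ f : M → ℝ, ContMDiff (𝓡 n) 𝓘(ℝ, ℝ) ∞ f ∧ (∀ x, |f x| ≤ 1) ∧
      (∀ x, |f x - Real.cos (Manifold.riemannianEDist (𝓡 n) p x).toReal| ≤
        Real.sqrt (2 * n * τ)) ∧
      (∀ x, 0 ≤ (PseudoRiemannianMetric.ofRiemannian h).dalembertian f x + n * f x) ∧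
      ∫ x, ((PseudoRiemannianMetric.ofRiemannian h).dalembertian f x + n * f x) ^ 2
          ∂riemannianMeasure h ≤
        (4 / τ ^ 2 + 2 * (n : ℝ) ^ 2) * (δ + (2 * n * Real.pi ^ (n - 1) * δ) ^ ((n : ℝ)⁻¹)) ^ 2 *
          (riemannianMeasure h univ).toReal ∧
      ∫ x, (PseudoRiemannianMetric.ofRiemannian h).normSq x
          ((PseudoRiemannianMetric.ofRiemannian h).hessian f x +
            f x • (PseudoRiemannianMetric.ofRiemannian h).toBilinForm x) ∂riemannianMeasure h ≤
        (4 / τ ^ 2 + 2 * (n : ℝ) ^ 2) * (δ + (2 * n * Real.pi ^ (n - 1) * δ) ^ ((n : ℝ)⁻¹)) ^ 2 *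
            (riemannianMeasure h univ).toReal +
          ((n : ℝ) - 1) * Real.sqrt
            ((4 / τ ^ 2 + 2 * (n : ℝ) ^ 2) *
                (δ + (2 * n * Real.pi ^ (n - 1) * δ) ^ ((n : ℝ)⁻¹)) ^ 2 *
                (riemannianMeasure h univ).toReal * (riemannianMeasure h univ).toReal) := by
  have hg : (PseudoRiemannianMetric.ofRiemannian h).IsRiemannian :=
    PseudoRiemannianMetric.isRiemannian_ofRiemannian h
  have hvol : (PseudoRiemannianMetric.ofRiemannian h).riemVolume = riemannianMeasure h :=
    PseudoRiemannianMetric.riemVolume_eq hg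
  haveI : IsFiniteMeasure (riemannianMeasure h) := by
    rw [← hvol]; exact ⟨(PseudoRiemannianMetric.ofRiemannian h).riemVolume_univ_lt_top⟩
  obtain ⟨f, hf, h1, h2, h3, h4⟩ := exists_smooth_approx_cos_edist
    (PseudoRiemannianMetric.ofRiemannian h) hg hn (fun x v ↦ hRic x v) hδ hδn hpq hτ
  have hΔ : ∀ x, (PseudoRiemannianMetric.ofRiemannian h).laplaceBeltrami f x =
      (PseudoRiemannianMetric.ofRiemannian h).dalembertian f x := fun x ↦
    laplaceBeltrami_eq_dalembertian _ f x
  simp_rw [hΔ] at h3 h4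
  rw [hvol] at h4
  -- abbreviations
  set V : ℝ := (riemannianMeasure h univ).toReal with hV
  set K : ℝ := (4 / τ ^ 2 + 2 * (n : ℝ) ^ 2) *
    (δ + (2 * n * Real.pi ^ (n - 1) * δ) ^ ((n : ℝ)⁻¹)) ^ 2 * V with hK
  set A : ℝ := ∫ x, ((PseudoRiemannianMetric.ofRiemannian h).dalembertian f x + n * f x) ^ 2
    ∂riemannianMeasure h with hA
  set B : ℝ := ∫ x, f x ^ 2 ∂riemannianMeasure h with hB
  have hA0 : 0 ≤ A := integral_nonneg fun x ↦ sq_nonneg _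
  have hB0 : 0 ≤ B := integral_nonneg fun x ↦ sq_nonneg _
  have hBV : B ≤ V := by
    have h1' : ∫ x, f x ^ 2 ∂riemannianMeasure h ≤ ∫ _, (1 : ℝ) ∂riemannianMeasure h := by
      refine integral_mono_of_nonneg (Eventually.of_forall fun x ↦ sq_nonneg _)
        (integrable_const _) (Eventually.of_forall fun x ↦ ?_)
      have := sq_le_sq' (abs_le.1 (h1 x)).1 (abs_le.1 (h1 x)).2
      simpa using this
    rwa [integral_const, smul_eq_mul, mul_one, measureReal_def] at h1'
  have hn1 : (0 : ℝ) ≤ (n : ℝ) - 1 := by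
    have : (2 : ℝ) ≤ n := by exact_mod_cast hn
    linarith
  have hHess := colding_integral_normSq_hessian_add_smul_le_sqrt h (by omega) hRic hf
  refine ⟨f, hf, h1, h2, h3, h4, hHess.trans ?_⟩
  have hsq : Real.sqrt (A * B) ≤ Real.sqrt (K * V) :=
    Real.sqrt_le_sqrt (mul_le_mul h4 hBV hB0 (hA0.trans h4))
  nlinarith [hsq, h4]

end FactVocabulary

end Literature.Geometry.Riemannian

end
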